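import Summits.QuantumFields.BalabanUV.Beta.GAN24.CouplingLetterDiagrams
import Summits.QuantumFields.BalabanUV.Beta.GAN24.ResolventCurveTaylor

/-!
# `BalabanUV.Beta.GAN24.CouplingCurveTaylor` — binder row G-an2-4 ∕ (CONV-C), route R7 «TWO CURRENCIES», PART 241: EVERY s-DERIVATIVE AT `s = 0` OF THE INVERSE EFFECTIVE COVARIANCE
# ALONG A REAL CURVE OF COUPLING LETTERS THROUGH THE FREE OPERATOR, `s ↦ Δ_a^{(k)} + A_{t,k}(s)`, `A(s) = P(V(s)) + P(V(s))ᴴ + diag Z(s)`, `A(0) = 0` — THE SHAPE OF THE EXACT ABELIAN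
# COVARIANT LAPLACIAN ALONG A CURVE OF TRANSPORTERS `U_s` WITH `U_0 = 1` (NE2's `covPert_eq`: `Δ^{U_s} − Δ^1 = P(−w_s) + P(−w_s)ᴴ + diag z_s`; the background enters NONLINEARLY, through
# `U_s` and `U_s*`, so the natural parameter is REAL) — ON `ℤ^d`, MODULO ONLY EL₁ OF THE JETS AT `s = 0`.  PART 240's curve Faà di Bruno says `∂^N_s[(c_k(s))⁻¹]|₀` is ONE finite
# `ℤ`-combination of diagrams whose word letters are the DERIVATIVE letters `A^{(j)}(0) = P(V^{(j)}(0)) + P(V^{(j)}(0))ᴴ + diag Z^{(j)}(0)`, `1 ≤ j ≤ N` — coupling letters again — so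
# PART 238's END applies on the finite alphabet `Fin (N+1)`: the hypotheses are the Lipschitz ∕ bounded-background constants of the first `N` jets at `s = 0`, uniform in the volume, and
# their EL₁; the jets are given ENTRYWISE as a tower `∂_sV^{(j)} = V^{(j+1)}`, `∂_sZ^{(j)} = Z^{(j+1)}` (§1 lifts entrywise towers to the matrix tower of PART 240) (unit b2b-balaban-gan24-p3,
# gen 65; v1)

NOT IN PRINT; OUR PROOF ([folklore] bookkeeping BY NAME over PART 240 (`iteratedDeriv_inv_eq_curveDiagramSum` with its letter bound), PART 238 (`conv_couplingDiagramSum_of_tendsto_background`),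
PART 161 (`exists_clm_avgTow`), PART 118 (`isUnit_det_unitCovB_and_opNorm_inv_le`), `isUnit_det_calDalev`, Mathlib's `Matrix.matrix_eq_sum_single`, `HasDerivAt.smul_const ∕ fun_sum ∕ star ∕
mul_const`, `List.foldr_map`, `List.foldr_ext`; [Balaban1985BackgroundPropagators] (3.3) p. 390 and [Balaban1987RG1] (1.21)–(1.22) p. 264 LOCATE the shapes; nothing printed is a hypothesis).
HONEST FRAMING (cell contract, verbatim): «discharging `BetaPertH` makes Bałaban's UV stability UNCONDITIONAL — a real constructive-QFT result; it is NOT the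
continuum limit and NOT the Clay problem.»  HONEST DEPENDENCY (verbatim): «continuum YM on T⁴ ⇐ BetaPertH ∧ nine spine estimates (0/9 proved); BetaPertH ⇐
(D1) ∧ (D4) ∧ CAP+tail; G-an2-4 gates asym, D1 and NE2/3/4.»

WHAT THIS FILE PROVES (0 sorry, 0 `def`):
* §1 (GENERIC, real curves of complex matrices in the scoped `ℓ²`-operator norm) **`hasDerivAt_of_entry`** (entrywise derivatives ⟹ the matrix derivative — `Σ_{ab} A_{ab}(s)•E_{ab}`),
  `Pmodel_apply`, `Pmodel_zero`, **`hasDerivAt_Pmodel_curve`**, **`hasDerivAt_conjTranspose_Pmodel_curve`**, `hasDerivAt_diagonal_curve`, **`hasDerivAt_couplingLetter_curve`** (the matrix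
  jet tower of a curve of coupling letters from the entrywise jet towers of its backgrounds).
* §2 **`conv_iteratedDeriv_invPertCov_couplingCurve_of_tendsto_background`** (`d ≥ 3`, `L ≥ 2`, `a > 0`, `μ ≠ ν`, even cubic volumes `2(t+1)`, order `N`; jets `V^{(j)}_t(s)`, `Z^{(j)}_t(s)`
  with entrywise towers, `V^{(0)}_t(0) = 0`, `Z^{(0)}_t(0) = 0`, and for `j ≤ N`: `V^{(j)}_t(0)` Lipschitz `(α, β)`, `Z^{(j)}_t(0)` bounded `(α′, β′)` uniformly in `t`, DISPLAYING ONLY their EL₁):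
  the tower family `(t, k) ↦ ∂^N_s[(L^{dk}Q_k(Δ_a^{(k)} + A_{t,k}(s))⁻¹Q_kᴴ)⁻¹]|_{s=0}` has `∃ κ > 0, B, B′ ≥ 0, Π` with `IsInfiniteVolumeLimit`, `UniformDecay Π μ ν B (κ∕d)`,
  `StepRate Π μ ν B′ (κ∕d) (√(L⁻¹))`, `KernelInputs d Π`, `∀ k, |secondMoment (Π k) μ ν − secondMoment (limKernelOf Π) μ ν| ≤ β′_d(B′∕(1−√(L⁻¹)), κ∕d)·(√(L⁻¹))^k`.
WHAT IT DOES NOT DO: the identification `V^{(0)}_t(s) = −w(U_{t,s})`, `Z^{(0)}_t(s) = z(U_{t,s})` for a concrete transporter curve (one `rw [covPert_eq]` for the statement; the jets of `w_s = η⁻¹(U_s − 1)`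
and of `z_s` are the user's — e.g. `U_s = exp(sθ)`: `w^{(j)}(0) = η^{j−1}(ηθ... )` explicit; follower PART); base points `s₀ ≠ 0`; several parameters (polarisation); Bałaban's `−∂P∂*` ∕
`aQ(U)*Q(U)` parts and the non-abelian colour structure; `d ≤ 2` ∕ odd volumes.  SUPPLIER work; NEVER «G-an2-4 closed»; NOT (CONV-C), NOT D1, NOT `BetaPertH`, NOT continuum, NOT Clay.
Records: `HOME/b2b-balaban-gan24-p3/gen65/README.md`.
-/

noncomputable section

open scoped BigOperators ComplexConjugate Matrix Matrix.Norms.L2Operator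
open Filter Topology

namespace Summit.QuantumFields.BalabanUV.Beta.GAN24.CouplingCurveTaylor

open Literature.MathematicalPhysics.QuantumFieldTheory.Balaban1983to89
open Literature.MathematicalPhysics.QuantumFieldTheory.Balaban1983to89.B5Prop11Plancherel (Tor fine fdiff)
open Literature.MathematicalPhysics.QuantumFieldTheory.Balaban1983to89.B5G183RateUnitTower (lev)
open Literature.MathematicalPhysics.QuantumFieldTheory.Balaban1983to89.B12Sec2to5 (betaPrime510)
open Literature.MathematicalPhysics.QuantumFieldTheory.Balaban1983to89.Beta (Site IsInfiniteVolumeLimit)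
open Literature.MathematicalPhysics.QuantumFieldTheory.Balaban1983to89.Beta.FreeLegDictionary (cubic)
open Literature.MathematicalPhysics.QuantumFieldTheory.Balaban1983to89.Beta.BlockKernelVolumeSockets (evenPeriod tendsto_evenPeriod)
open Literature.MathematicalPhysics.QuantumFieldTheory.Balaban1983to89.Beta.VectorTails (castT)
open Literature.MathematicalPhysics.QuantumFieldTheory.Balaban1983to89.Beta.LimitRate (StepRate limKernelOf KernelInputs)
open Summit.QuantumFields.BalabanUV.T4Continuum
open Summit.QuantumFields.BalabanUV.T4Continuum.CovariantAveragingTower (Atow avgTow)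
open Summit.QuantumFields.BalabanUV.T4Continuum.BalabanAveragedTowerUnit (idx QBlev calGlev unitCovB)
open Summit.QuantumFields.BalabanUV.T4Continuum.BalabanAveragedCoerciveTower (unitIdx)
open Summit.QuantumFields.BalabanUV.T4Continuum.KingPairingPlantedLaw (calDalev calDalev_inv isUnit_det_calDalev)
open Summit.QuantumFields.BalabanUV.T4Continuum.FirstOrderBackgroundModel (LipschitzBackground Pmodel firstOrder)
open Summit.QuantumFields.BalabanUV.T4Continuum.PerturbationAlgebra (BoundedBackground)
open Summit.QuantumFields.BalabanUV.Beta.GAN24.EffectiveFormInsertionLaw (isUnit_det_unitCovB_and_opNorm_inv_le)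
open Summit.QuantumFields.BalabanUV.Beta.GAN24.BackgroundExpansionTaylor (exists_clm_avgTow)
open Summit.QuantumFields.BalabanUV.Beta.GAN24.CouplingLetterDiagrams (conv_couplingDiagramSum_of_tendsto_background)
open Summit.QuantumFields.BalabanUV.Beta.GAN24.ResolventCurveTaylor (iteratedDeriv_inv_eq_curveDiagramSum)

variable {d : ℕ} (L : ℕ) [NeZero L]

/-! ## §1 Entrywise jet towers lift to the matrix jet tower of a curve of coupling letters -/

section Entry

variable {ι : Type*} [Fintype ι] [DecidableEq ι]

omit [NeZero L] in
/-- **`hasDerivAt_of_entry`** — a real curve of complex matrices whose ENTRIES are differentiable is differentiable in the `ℓ²`-operator norm, with the matrix of entry derivatives as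
derivative (`A(s) = Σ_{ab} A_{ab}(s) • E_{ab}`, finite sum). [folklore] -/
theorem hasDerivAt_of_entry {A : ℝ → Matrix ι ι ℂ} {A' : Matrix ι ι ℂ} {s : ℝ} (h : ∀ a b, HasDerivAt (fun v => A v a b) (A' a b) s) : HasDerivAt A A' s := by
  have e : ∀ B : Matrix ι ι ℂ, B = ∑ a, ∑ b, B a b • Matrix.single a b (1 : ℂ) := fun B => by
    conv_lhs => rw [Matrix.matrix_eq_sum_single B]
    simp only [Matrix.smul_single, smul_eq_mul, mul_one]
  have hsum : HasDerivAt (fun v => ∑ a, ∑ b, A v a b • Matrix.single a b (1 : ℂ)) (∑ a, ∑ b, A' a b • Matrix.single a b (1 : ℂ)) s :=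
    HasDerivAt.fun_sum fun a _ => HasDerivAt.fun_sum fun b _ => (h a b).smul_const _
  rw [e A']
  exact hsum.congr_of_eventuallyEq (Eventually.of_forall fun v => e (A v))

end Entry

section Letters

variable (M : Fin d → ℕ) [hM : ∀ μ, NeZero (M μ)]

/-- the entries of the first-order coupling: `P(W)^{(k)}(a, b) = Σ_μ W^{(k)}_μ(a)·∇_μ(a, b)`. [folklore] -/
theorem Pmodel_apply (W : (k : ℕ) → Fin d → (idx L M k → ℂ)) (k : ℕ) (a b : idx L M k) :
    Pmodel L M W k a b = ∑ μ, W k μ a * fdiff (fine (lev L k) M) ((lev L k : ℕ) : ℂ) μ a b := by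
  unfold Pmodel firstOrder
  rw [Matrix.sum_apply]
  refine Finset.sum_congr rfl fun μ _ => ?_
  rw [Matrix.diagonal_mul]

/-- `P(0) = 0`. [folklore] -/
theorem Pmodel_zero (k : ℕ) : Pmodel L M (0 : (k : ℕ) → Fin d → (idx L M k → ℂ)) k = 0 := by
  ext a b
  rw [Pmodel_apply, Matrix.zero_apply]
  simp only [Pi.zero_apply, zero_mul, Finset.sum_const_zero]

/-- **`hasDerivAt_Pmodel_curve`** — a real curve of backgrounds with entrywise derivative `V′` gives `∂_sP(V(s)) = P(V′)` (the coupling is linear with constant coefficients). [folklore] -/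
theorem hasDerivAt_Pmodel_curve {V : ℝ → (k : ℕ) → Fin d → (idx L M k → ℂ)} {V' : (k : ℕ) → Fin d → (idx L M k → ℂ)} (k : ℕ) {s : ℝ}
    (h : ∀ μ x, HasDerivAt (fun v => V v k μ x) (V' k μ x) s) : HasDerivAt (fun v => Pmodel L M (V v) k) (Pmodel L M V' k) s := by
  refine hasDerivAt_of_entry fun a b => ?_
  simp only [Pmodel_apply]
  exact HasDerivAt.fun_sum fun μ _ => (h μ a).mul_const _

/-- **`hasDerivAt_conjTranspose_Pmodel_curve`** — and `∂_s[P(V(s))ᴴ] = P(V′)ᴴ` (REAL parameter: differentiation commutes with `star`). [folklore] -/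
theorem hasDerivAt_conjTranspose_Pmodel_curve {V : ℝ → (k : ℕ) → Fin d → (idx L M k → ℂ)} {V' : (k : ℕ) → Fin d → (idx L M k → ℂ)} (k : ℕ) {s : ℝ}
    (h : ∀ μ x, HasDerivAt (fun v => V v k μ x) (V' k μ x) s) : HasDerivAt (fun v => (Pmodel L M (V v) k)ᴴ) (Pmodel L M V' k)ᴴ s := by
  refine hasDerivAt_of_entry fun a b => ?_
  simp only [Matrix.conjTranspose_apply, Pmodel_apply]
  exact (HasDerivAt.fun_sum fun μ _ => (h μ b).mul_const _).star

/-- `∂_s diag Z(s) = diag Z′` from entrywise derivatives. [folklore] -/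
theorem hasDerivAt_diagonal_curve {Z : ℝ → (k : ℕ) → (idx L M k → ℂ)} {Z' : (k : ℕ) → (idx L M k → ℂ)} (k : ℕ) {s : ℝ}
    (h : ∀ x, HasDerivAt (fun v => Z v k x) (Z' k x) s) : HasDerivAt (fun v => Matrix.diagonal (Z v k)) (Matrix.diagonal (Z' k)) s := by
  refine hasDerivAt_of_entry fun a b => ?_
  by_cases hab : a = b
  · subst hab
    simp only [Matrix.diagonal_apply_eq]
    exact h a
  · simp only [Matrix.diagonal_apply_ne _ hab]
    exact hasDerivAt_const s 0

/-- **`hasDerivAt_couplingLetter_curve` — THE MATRIX JET TOWER OF A CURVE OF COUPLING LETTERS FROM THE ENTRYWISE JET TOWERS OF ITS BACKGROUNDS**: if `∂_sV^{(j)} = V^{(j+1)}` and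
`∂_sZ^{(j)} = Z^{(j+1)}` entrywise, then `∂_s[P(V^{(j)}(s)) + P(V^{(j)}(s))ᴴ + diag Z^{(j)}(s)] = P(V^{(j+1)}(s)) + P(V^{(j+1)}(s))ᴴ + diag Z^{(j+1)}(s)` in the `ℓ²`-operator norm — the
hypothesis of PART 240. [folklore] -/
theorem hasDerivAt_couplingLetter_curve {V : ℕ → ℝ → (k : ℕ) → Fin d → (idx L M k → ℂ)} {Z : ℕ → ℝ → (k : ℕ) → (idx L M k → ℂ)}
    (hVd : ∀ j s k μ x, HasDerivAt (fun v => V j v k μ x) (V (j + 1) s k μ x) s) (hZd : ∀ j s k x, HasDerivAt (fun v => Z j v k x) (Z (j + 1) s k x) s) (k : ℕ) (j : ℕ) (s : ℝ) :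
    HasDerivAt (fun v => Pmodel L M (V j v) k + (Pmodel L M (V j v) k)ᴴ + Matrix.diagonal (Z j v k))
      (Pmodel L M (V (j + 1) s) k + (Pmodel L M (V (j + 1) s) k)ᴴ + Matrix.diagonal (Z (j + 1) s k)) s :=
  ((hasDerivAt_Pmodel_curve L M k (hVd j s k)).add (hasDerivAt_conjTranspose_Pmodel_curve L M k (hVd j s k))).add (hasDerivAt_diagonal_curve L M k (hZd j s k))

end Letters

/-! ## §2 The END along a curve of coupling letters through the free operator, modulo only EL₁ of the first `N` jets at `s = 0` -/

section Curve

variable (a : ℝ) (ha : 0 < a)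

/-- **`conv_iteratedDeriv_invPertCov_couplingCurve_of_tendsto_background` — EVERY s-DERIVATIVE AT `s = 0` OF `(c_k(s))⁻¹` ALONG A REAL CURVE OF COUPLING LETTERS THROUGH THE FREE OPERATOR,
ON `ℤ^d`, MODULO ONLY EL₁ OF THE JETS** [our proof] (`d ≥ 3`, `L ≥ 2`, `a > 0`, `μ ≠ ν`, even cubic volumes `2(t+1)`, order `N`).  Data: entrywise jet towers `V^{(j)}_t(s)` (connections) and
`Z^{(j)}_t(s)` (zeroth-order fields) on every level of every volume, `V^{(0)}_t(0) = 0`, `Z^{(0)}_t(0) = 0` (the curve passes through the FREE operator at `s = 0`); for `j ≤ N` the jets at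
`s = 0` are Lipschitz `(α, β)` ∕ bounded `(α′, β′)` backgrounds uniformly in `t` with EL₁.  THEN the tower family
`(t, k) ↦ ∂^N_s[(L^{dk}Q_k(Δ_a^{(k)} + P(V^{(0)}_t(s)) + P(V^{(0)}_t(s))ᴴ + diag Z^{(0)}_t(s))⁻¹Q_kᴴ)⁻¹]|_{s=0}` has the β-cell's whole `LimitRate` END: PART 240's uniform curve Faà di Bruno at
`s = 0` (letters `c_k⁻¹` and the words in the derivative letters `A^{(j)}(0)`, `1 ≤ j ≤ N`, by §1's matrix jet tower) + PART 238's END on the finite alphabet `Fin (N+1)` (`i ↦ A^{(i)}(0)`).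
The exact abelian covariant Laplacian along a transporter curve `U_{t,s}` with `U_{t,0} = 1` is the case `V^{(0)}_t(s) = −w(U_{t,s})`, `Z^{(0)}_t(s) = z(U_{t,s})` (NE2's `covPert_eq`).
[cite: Balaban1985BackgroundPropagators, (3.3) p.390 (covariant derivative, shape); Balaban1987RG1, (1.21)–(1.22) p.264 (shapes)] -/
theorem conv_iteratedDeriv_invPertCov_couplingCurve_of_tendsto_background (hL : 2 ≤ L) (hd : 3 ≤ d) {μ ν : Fin d} (hne : μ ≠ ν) {α β α' β' : ℝ} (N : ℕ)
    {V : ℕ → (t : ℕ) → ℝ → (k : ℕ) → Fin d → (idx L (cubic d (evenPeriod t)) k → ℂ)} {Z : ℕ → (t : ℕ) → ℝ → (k : ℕ) → (idx L (cubic d (evenPeriod t)) k → ℂ)}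
    (hVd : ∀ j t s k μ x, HasDerivAt (fun v => V j t v k μ x) (V (j + 1) t s k μ x) s) (hZd : ∀ j t s k x, HasDerivAt (fun v => Z j t v k x) (Z (j + 1) t s k x) s)
    (hV00 : ∀ t, V 0 t 0 = 0) (hZ00 : ∀ t, Z 0 t 0 = 0)
    (hV : ∀ j, j ≤ N → ∀ t, LipschitzBackground L (cubic d (evenPeriod t)) (V j t 0) α β) (hZ : ∀ j, j ≤ N → ∀ t, BoundedBackground L (cubic d (evenPeriod t)) (Z j t 0) α' β')
    (hV1 : ∀ j, j ≤ N → ∀ k (μ f : Fin d) (z : Fin d → ℤ), ∃ s : ℂ, Tendsto (fun t => V j t 0 k μ (castT (cubic d (lev L k * evenPeriod t)) z, f)) atTop (𝓝 s))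
    (hZ1 : ∀ j, j ≤ N → ∀ k (f : Fin d) (z : Fin d → ℤ), ∃ s : ℂ, Tendsto (fun t => Z j t 0 k (castT (cubic d (lev L k * evenPeriod t)) z, f)) atTop (𝓝 s)) :
    ∃ κ B B' : ℝ, 0 < κ ∧ 0 ≤ B ∧ 0 ≤ B' ∧ ∃ Pinf : ℕ → B12Beta.Kernel d,
      (∀ k, IsInfiniteVolumeLimit evenPeriod
        (fun t μ' ν' (z : Site d (evenPeriod t)) =>
          ((iteratedDeriv N (fun s : ℝ => (avgTow (QBlev L (cubic d (evenPeriod t))) ((L : ℝ) ^ d)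
              (fun k' => (calDalev L (cubic d (evenPeriod t)) a ha k'
                + (Pmodel L (cubic d (evenPeriod t)) (V 0 t s) k' + (Pmodel L (cubic d (evenPeriod t)) (V 0 t s) k')ᴴ + Matrix.diagonal (Z 0 t s k')))⁻¹) k)⁻¹) 0)
            ((unitIdx L (cubic d (evenPeriod t))).symm (z, μ')) ((unitIdx L (cubic d (evenPeriod t))).symm (0, ν'))).re) (Pinf k)) ∧
      Beta.LimitRate.UniformDecay Pinf μ ν B (κ / d) ∧ StepRate Pinf μ ν B' (κ / d) (Real.sqrt ((L : ℝ)⁻¹)) ∧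
      (∃ K : KernelInputs d Pinf, K.θ = Real.sqrt ((L : ℝ)⁻¹) ∧ K.c₀ = betaPrime510 d (B' / (1 - Real.sqrt ((L : ℝ)⁻¹))) (κ / d) ∧ K.Pinf = limKernelOf Pinf ∧ K.μ = μ ∧ K.ν = ν) ∧
      (∀ k, |B12Beta.secondMoment (Pinf k) μ ν - B12Beta.secondMoment (limKernelOf Pinf) μ ν|
          ≤ betaPrime510 d (B' / (1 - Real.sqrt ((L : ℝ)⁻¹))) (κ / d) * Real.sqrt ((L : ℝ)⁻¹) ^ k) := by
  obtain ⟨J, hJ, z, ℓ, hℓ, hN⟩ := iteratedDeriv_inv_eq_curveDiagramSum N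
  -- the finite alphabet of derivative letters `i ↦ A^{(i)}(0)`, `i : Fin (N+1)`, and the truncation of word letters (the identity on the letters that occur)
  set τ : ℕ → Fin (N + 1) := fun j => ⟨min j N, by omega⟩ with hτ
  have hτv : ∀ j, j ≤ N → ((τ j : Fin (N + 1)) : ℕ) = j := fun j hj => by simp [hτ, Nat.min_eq_left hj]
  -- PART 238's END for the truncated combination
  obtain ⟨κ, B, B', hκ, hB, hB', Pinf, hIVL, hUD, hSR, hK, hsm⟩ :=
    conv_couplingDiagramSum_of_tendsto_background L a ha (σ := Fin (N + 1)) (V₁ := fun i t => V (i : ℕ) t 0) (V₂ := fun i t => V (i : ℕ) t 0) (W := fun i t => Z (i : ℕ) t 0)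
      hL hd hne (fun i t => hV i (Nat.lt_succ_iff.mp i.2) t) (fun i t => hV i (Nat.lt_succ_iff.mp i.2) t) (fun i t => hZ i (Nat.lt_succ_iff.mp i.2) t)
      (fun i k => hV1 i (Nat.lt_succ_iff.mp i.2) k) (fun i k => hV1 i (Nat.lt_succ_iff.mp i.2) k) (fun i k => hZ1 i (Nat.lt_succ_iff.mp i.2) k)
      Finset.univ (fun i => (z i : ℂ)) (fun i => (ℓ i).map (Option.map (List.map τ)))
  refine ⟨κ, B, B', hκ, hB, hB', Pinf, fun k => ?_, hUD, hSR, hK, hsm⟩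
  -- the identity at `s = 0`, volume by volume
  have key : ∀ t, iteratedDeriv N (fun s : ℝ => (avgTow (QBlev L (cubic d (evenPeriod t))) ((L : ℝ) ^ d)
        (fun k' => (calDalev L (cubic d (evenPeriod t)) a ha k'
          + (Pmodel L (cubic d (evenPeriod t)) (V 0 t s) k' + (Pmodel L (cubic d (evenPeriod t)) (V 0 t s) k')ᴴ + Matrix.diagonal (Z 0 t s k')))⁻¹) k)⁻¹) 0
      = (∑ i ∈ Finset.univ, (fun i => (z i : ℂ)) i • ((((ℓ i).map (Option.map (List.map τ))).map fun o => o.elim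
          (fun t k => (unitCovB L (cubic d (evenPeriod t)) a ha k)⁻¹)
          (fun w t k => avgTow (QBlev L (cubic d (evenPeriod t))) ((L : ℝ) ^ d)
            (fun k' => List.foldr (fun i Nm => calGlev L (cubic d (evenPeriod t)) a ha k'
              * (Pmodel L (cubic d (evenPeriod t)) ((fun (i : Fin (N + 1)) t => V (i : ℕ) t 0) i t) k'
                + (Pmodel L (cubic d (evenPeriod t)) ((fun (i : Fin (N + 1)) t => V (i : ℕ) t 0) i t) k')ᴴ
                + Matrix.diagonal ((fun (i : Fin (N + 1)) t => Z (i : ℕ) t 0) i t k')) * Nm)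
              (calGlev L (cubic d (evenPeriod t)) a ha k') w) k)).prod)) t k := by
    intro t
    set M := cubic d (evenPeriod t) with hM
    obtain ⟨Φ, hΦ⟩ := exists_clm_avgTow (QBlev L M) ((L : ℝ) ^ d) k
    set D : Matrix (idx L M k) (idx L M k) ℂ := calDalev L M a ha k with hD
    set Pd : ℕ → ℝ → Matrix (idx L M k) (idx L M k) ℂ := fun j s => Pmodel L M (V j t s) k + (Pmodel L M (V j t s) k)ᴴ + Matrix.diagonal (Z j t s k) with hPd
    have hF : (fun s : ℝ => (avgTow (QBlev L M) ((L : ℝ) ^ d)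
        (fun k' => (calDalev L M a ha k' + (Pmodel L M (V 0 t s) k' + (Pmodel L M (V 0 t s) k')ᴴ + Matrix.diagonal (Z 0 t s k')))⁻¹) k)⁻¹)
        = fun s : ℝ => (Φ (D + Pd 0 s)⁻¹)⁻¹ := by
      funext s; rw [hΦ]
    have hPdD : ∀ j v, HasDerivAt (Pd j) (Pd (j + 1) v) v := fun j v => hasDerivAt_couplingLetter_curve L M (fun j s k μ x => hVd j t s k μ x) (fun j s k x => hZd j t s k x) k j v
    have hP00 : Pd 0 0 = 0 := by
      show Pmodel L M (V 0 t 0) k + (Pmodel L M (V 0 t 0) k)ᴴ + Matrix.diagonal (Z 0 t 0 k) = 0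
      rw [hV00 t, hZ00 t, Pmodel_zero, Matrix.conjTranspose_zero, Pi.zero_apply, add_zero, zero_add]
      exact Matrix.diagonal_zero
    have ec : Φ D⁻¹ = unitCovB L M a ha k := by
      rw [hD, calDalev_inv]
      exact (hΦ (calGlev L M a ha)).symm
    have h0 : IsUnit (D + Pd 0 0).det := by rw [hP00, add_zero]; exact isUnit_det_calDalev L M a ha k
    have hc0 : IsUnit (Φ (D + Pd 0 0)⁻¹).det := by rw [hP00, add_zero, ec]; exact (isUnit_det_unitCovB_and_opNorm_inv_le L M a ha k).1
    rw [hF, hN D Pd Φ 0 hPdD h0 hc0, Finset.sum_apply, Finset.sum_apply]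
    refine Finset.sum_congr rfl fun i _ => ?_
    rw [Pi.smul_apply, Pi.smul_apply, Pi.list_prod_apply, Pi.list_prod_apply, List.map_map, List.map_map, List.map_map]
    congr 1
    refine congrArg List.prod (List.map_congr_left fun o ho => ?_)
    cases o with
    | none =>
      simp only [Function.comp_apply, Option.map_none, Option.elim, hP00, add_zero, ec]
      rfl
    | some w =>
      simp only [Function.comp_apply, Option.map_some, Option.elim, hP00, add_zero]
      rw [hΦ, hD, calDalev_inv, List.foldr_map]
      refine congrArg Φ (List.foldr_ext _ _ _ fun j hj Nm => ?_)
      obtain ⟨-, hjN⟩ := hℓ i w ho j hj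
      have ej : ((τ j : Fin (N + 1)) : ℕ) = j := hτv j hjN
      simp only [hPd, ej]
      rfl
  have e : (fun t μ' ν' (x : Site d (evenPeriod t)) =>
      ((iteratedDeriv N (fun s : ℝ => (avgTow (QBlev L (cubic d (evenPeriod t))) ((L : ℝ) ^ d)
          (fun k' => (calDalev L (cubic d (evenPeriod t)) a ha k'
            + (Pmodel L (cubic d (evenPeriod t)) (V 0 t s) k' + (Pmodel L (cubic d (evenPeriod t)) (V 0 t s) k')ᴴ + Matrix.diagonal (Z 0 t s k')))⁻¹) k)⁻¹) 0)
        ((unitIdx L (cubic d (evenPeriod t))).symm (x, μ')) ((unitIdx L (cubic d (evenPeriod t))).symm (0, ν'))).re)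
      = fun t μ' ν' (x : Site d (evenPeriod t)) =>
      (((∑ i ∈ Finset.univ, (fun i => (z i : ℂ)) i • ((((ℓ i).map (Option.map (List.map τ))).map fun o => o.elim
          (fun t k => (unitCovB L (cubic d (evenPeriod t)) a ha k)⁻¹)
          (fun w t k => avgTow (QBlev L (cubic d (evenPeriod t))) ((L : ℝ) ^ d)
            (fun k' => List.foldr (fun i Nm => calGlev L (cubic d (evenPeriod t)) a ha k'
              * (Pmodel L (cubic d (evenPeriod t)) ((fun (i : Fin (N + 1)) t => V (i : ℕ) t 0) i t) k'
                + (Pmodel L (cubic d (evenPeriod t)) ((fun (i : Fin (N + 1)) t => V (i : ℕ) t 0) i t) k')ᴴ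
                + Matrix.diagonal ((fun (i : Fin (N + 1)) t => Z (i : ℕ) t 0) i t k')) * Nm)
              (calGlev L (cubic d (evenPeriod t)) a ha k') w) k)).prod)) t k)
        ((unitIdx L (cubic d (evenPeriod t))).symm (x, μ')) ((unitIdx L (cubic d (evenPeriod t))).symm (0, ν'))).re := by
    funext t μ' ν' x
    rw [key t]
  rw [e]
  exact hIVL k

end Curve

end Summit.QuantumFields.BalabanUV.Beta.GAN24.CouplingCurveTaylor

end
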